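import Summits.BirchSwinnertonDyer.BirchSwinnertonDyer.Theses.UniversalToricDescent
import Summits.BirchSwinnertonDyer.BirchSwinnertonDyer.Theorems.UniversalToricDescentWildSplitWaldspurgerAtThreeFlat
import Summits.BirchSwinnertonDyer.Rank1Residual.X11b.UnrIntegersValuationRing
import Summits.BirchSwinnertonDyer.Rank1Residual.X11b.PadicComplexInertiaFixed
import HarnessLib

/-!
# Route `UniversalToricDescent`, crux #4 `WildSplitWaldspurgerAtThree` (stmt-BirchSwinnertonDyer-20385): the crux
# AS TYPED follows from its pure EXISTENCE HALF («an `R₀`-valued BDP frame for `Dt.f` exists at the wild split `3`»)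
# and the refereed Liu–Zhang–Zhang input — the VALUE clause `L(𝟙) = u·(log_{ω_E} P / c)²`, `u ∈ R₀ˣ`, is then
# AUTOMATIC (kernel glue for a D-0019 split of crux #4)

Prover seat `bsd-potss-kmc` (g19), 2026-08-27. HONEST FRAMING: ONE THEOREM (0 definitions, 0 named facts, 0
`sorry`), CONDITIONAL on (i) the refereed input `LiuZhangZhang2018.thm151_thm153_modularCurve_heegnerVector_additive`
(Duke Math. J. 167 (2018) Thm 1.5.1 ∧ 1.5.3 at `p² ∣ N`, p518041) and (ii) the displayed hypothesis `hE` = the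
EXISTENCE HALF of crux #4 with its value clause deleted — «for `W` on the wild class at `3`, `K` imaginary quadratic
with the Heegner hypothesis for `N`, `(κ, γ)` anticyclotomic and `𝔭 ∋ 3`: some embedding datum `ι′` induces `𝔭` and
an `R₀`-frame `(Ω_K ≠ 0, Ω_p ≠ 0, L ∈ R₀⟦T⟧)` with `IsBDPLFunction ι′ 𝔭 κ γ Dt.f Ω_K Ω_p L` exists» — which is NOT in
print at `27 ∣ N` (Castella–Hsieh 2018 Def. 3.5: `p ∤ N`; Castella 2018 Thm. 3.1: `N` square-free; the natural proof,
the BDP/CH measure of the born-depleted form `f_E = f_E^{[3]}` at tame level `N/27`, is unprinted) and is the honest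
research content of crux #4. Nothing is closed by this file; BSD₃ is proved for no curve.

## The theorem

**`wildSplitWaldspurgerAtThree_of_lzz_of_frame`**: `hL → hE → WildSplitWaldspurgerAtThree`. Proof: take the frame of
`hE`; read it in `𝓞_{ℂ₃}⟦T⟧` (`R1.isBDPLFunctionInt_map`); the companion file's
`UniversalToricDescentWaldspurgerFlat.wildSplitWaldspurgerAtThree_flat_forall` (value of EVERY ♭-frame: `u₀·(log_ω P/c)²`,
`‖u₀‖ = 1`) pins the constant term; `[T⁰]L ∈ R₀` and `(log_ω P/c)² ∈ ℚ₃ˣ`, so `u := [T⁰]L/(log_ω P/c)² ∈ Frac R₀` has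
norm one, lies in `R₀` (valuation ring: `R1.mem_unrIntegers_of_mem_fracUnr`) and is a unit there
(`unrIntegers.isUnit_iff_norm_eq_one`). No Hsieh input is needed on this road.

FOR THE STEWARD (pss3): with this file a glued split of crux #4 (D-0019) into «∃ `R₀`-frame» (crux, text = `hE`)
+ a held published-input leaf `LiuZhangZhangAdditiveInput := thm151_thm153_modularCurve_heegnerVector_additive`
(as BED's 20316) closes the parent by a one-line glue `fun hE hL => wildSplitWaldspurgerAtThree_of_lzz_of_frame hL hE`;
the alternative ♭ re-type (crux #4♭ = companion file's `wildSplitWaldspurgerAtThree_flat`, closed modulo Hsieh + LZZ)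
deletes the `R₀`-descent from the route altogether.

References: [LiuZhangZhang2018] Duke Math. J. 167 (2018) Thm 1.5.1, Thm 1.5.3; [Castella2018] Thm. 3.1–3.2 (shapes);
[SerreLocalFields1979] Ch. II §5 (the valuation ring `R₀`).
-/

set_option autoImplicit false

-- D-0017 layout: summit = sub-problem, so `Summit.BirchSwinnertonDyer.BirchSwinnertonDyer.…` is the
-- mandated namespace of Theorems files (same option as the route's sibling Theorems files).
set_option linter.dupNamespace false

noncomputable section

open scoped Classical Topology NumberField

namespace Summit.BirchSwinnertonDyer.BirchSwinnertonDyer.Theorems.UniversalToricDescentWaldspurgerFlat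

open WeierstrassCurve NumberField IsDedekindDomain Field PowerSeries
  Literature.NumberTheory.EllipticCurves Literature.NumberTheory.EllipticCurves.ModularForms
  Literature.NumberTheory.EllipticCurves.LiuZhangZhang2018 Literature.NumberTheory.EllipticCurves.Rank1Residual
  Literature.NumberTheory.GaloisRepresentations
  Summit.BirchSwinnertonDyer.Rank1Residual Summit.BirchSwinnertonDyer.Rank1Residual.X11b
  Summit.BirchSwinnertonDyer.Rank1Residual.X11b.Halves
  Summit.BirchSwinnertonDyer.BirchSwinnertonDyer.Theses.UniversalToricDescent

/-- **Crux #4 AS TYPED from its existence half and the LZZ input.** Granted the refereed Liu–Zhang–Zhang fact at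
`p² ∣ N` (`hL`) and the EXISTENCE of an `R₀`-valued BDP frame for `Dt.f` at the wild split prime `3` (`hE`, the
value-free half of the crux; not in print at `27 ∣ N`), the crux `WildSplitWaldspurgerAtThree` holds: the value
`L(𝟙) = u·(log_{ω_E} P / c)²` with `u ∈ R₀ˣ` is forced on EVERY frame by the companion file's ♭-rigidity theorem
`wildSplitWaldspurgerAtThree_flat_forall` and the valuation-ring property of `R₀`. CONDITIONAL on `hL` and `hE`;
nothing booked. [cite: LiuZhangZhang2018, Thm 1.5.1 and Thm 1.5.3 (Duke Math. J. 167 pp. 748–749)]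
[cite: Castella2018, Thm. 3.1–3.2 (arXiv:1704.06608 pp. 8–9) (shapes)] -/
theorem wildSplitWaldspurgerAtThree_of_lzz_of_frame
    (hL : thm151_thm153_modularCurve_heegnerVector_additive)
    (hE : ∀ (W : WeierstrassCurve ℚ) [W.IsElliptic] [W.IsGloballyMinimal] (N : ℕ) [NeZero N] (K : Type) [Field K]
      [NumberField K] (Dt : ModularParametrizationData W N),
      Summit.BirchSwinnertonDyer.Rank1Residual.Additive.ClassO6 W 3 → W.conductorNorm ℤ = N →
      IsImaginaryQuadratic K → SatisfiesHeegnerHypothesis N K →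
      ∀ (κ : ZpExtension K 3), κ.IsAnticyclotomic → ∀ (γ : Field.absoluteGaloisGroup K)
        [Fact (κ.IsTopGenerator γ)] (𝔭 : HeightOneSpectrum (𝓞 K)), ((3 : ℕ) : 𝓞 K) ∈ 𝔭.asIdeal →
        ∃ ι' : PadicAlgCl 3 ≃+* ℂ, SchneiderFree.BranchInducesPrime 3 ι' 𝔭 ∧
          ∃ (ΩK : ℂ) (Ωp : ℂ_[3]) (L : UnrSeries 3), ΩK ≠ 0 ∧ Ωp ≠ 0 ∧ IsBDPLFunction ι' 𝔭 κ γ Dt.f ΩK Ωp L) :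
    WildSplitWaldspurgerAtThree := by
  intro W _ _ N _ K _ _ Dt H ι P hO6 _ _ hN hK hHN _ hP hPinf κ hκ γ _ 𝔭 h𝔭 he hf
  obtain ⟨ι', hι', ΩK, Ωp, L, hΩK, hΩp, hLfr⟩ := hE W N K Dt hO6 hN hK hHN κ hκ γ 𝔭 h𝔭
  refine ⟨ι', hι', ΩK, Ωp, L, hΩK, hΩp, hLfr, ?_⟩
  -- the frame read in `𝓞_{ℂ₃}⟦T⟧` and its value at `𝟙` (companion file, LZZ input)
  have hQ' : R1.IsBDPLFunctionInt 3 ι' 𝔭 κ γ Dt.f ΩK Ωp (PowerSeries.map (R1.unrToCpInt 3) L) :=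
    R1.isBDPLFunctionInt_map hLfr
  obtain ⟨u₀, hu₀, hv⟩ := wildSplitWaldspurgerAtThree_flat_forall hL W N K Dt H ι P hO6 hN hK hHN hP hPinf κ hκ γ
    𝔭 h𝔭 he hf ι' hι' hΩK hΩp hQ'
  set x : ℚ_[3] := logOmega W 3 (embAt K 3 𝔭 h𝔭 he hf) P / (Dt.c : ℚ_[3]) with hx
  have hv' : L.HasValueAt 0 (u₀ * (algebraMap ℚ_[3] ℂ_[3] x) ^ 2) :=
    (R1.intSeries_hasValueAt_map_iff 3 L _ _).mp hv
  have hcoef : ((PowerSeries.constantCoeff L : unrIntegers 3) : ℂ_[3]) =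
      u₀ * (algebraMap ℚ_[3] ℂ_[3] x) ^ 2 :=
    (UnrSeries.eq_constantCoeff_of_hasValueAt_zero hv').symm
  -- `x ≠ 0`: `P` of infinite order, `c ≠ 0`
  have hlogne : logOmega W 3 (embAt K 3 𝔭 h𝔭 he hf) P ≠ 0 := R1.logOmega_ne_zero W 3 _ hPinf
  have hcZ : Dt.c ≠ 0 := Dt.maninConstant_ne_zero_holds
  have hx0 : x ≠ 0 := div_ne_zero hlogne (by exact_mod_cast hcZ)
  have hx2 : x ^ 2 ≠ 0 := pow_ne_zero _ hx0
  -- the quotient `[T⁰]L / x²` has norm one, lies in `Frac R₀`, hence in `R₀`, hence is a unit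
  set y : ℂ_[3] := algebraMap ℚ_[3] ℂ_[3] (x ^ 2) with hy
  have hy0 : y ≠ 0 := (map_ne_zero_iff _ (algebraMap ℚ_[3] ℂ_[3]).injective).mpr hx2
  have hnorm : ‖((PowerSeries.constantCoeff L : unrIntegers 3) : ℂ_[3])‖ = ‖y‖ := by
    rw [hcoef, norm_mul, hu₀, one_mul, hy, map_pow]
  have hyF : y ∈ Subfield.closure (unrIntegers 3 : Set ℂ_[3]) := by
    rw [hy, IsScalarTower.algebraMap_apply ℚ_[3] (PadicAlgCl 3) ℂ_[3] (x ^ 2)]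
    exact PadicComplexTransport.algebraMap_padic_mem_fracUnr 3 (x ^ 2)
  set c₀ : ℂ_[3] := ((PowerSeries.constantCoeff L : unrIntegers 3) : ℂ_[3]) with hc₀
  have hw : c₀ / y ∈ Subfield.closure (unrIntegers 3 : Set ℂ_[3]) :=
    div_mem (Subfield.subset_closure (PowerSeries.constantCoeff L).2) hyF
  have hw1 : ‖c₀ / y‖ = 1 := by
    rw [norm_div, hc₀, hnorm, div_self (norm_ne_zero_iff.mpr hy0)]
  have hwR : c₀ / y ∈ unrIntegers 3 := R1.mem_unrIntegers_of_mem_fracUnr hw hw1.le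
  obtain ⟨u, hu⟩ := (unrIntegers.isUnit_iff_norm_eq_one ⟨c₀ / y, hwR⟩).mpr hw1
  refine ⟨u, ?_⟩
  have hval : ((u : unrIntegers 3) : ℂ_[3]) * (algebraMap ℚ_[3] ℂ_[3] x) ^ 2 = c₀ := by
    rw [hu, ← map_pow, ← hy]
    exact div_mul_cancel₀ c₀ hy0
  have h0 := L.hasValueAt_zero
  rw [← hc₀, ← hval] at h0
  exact h0

end Summit.BirchSwinnertonDyer.BirchSwinnertonDyer.Theorems.UniversalToricDescentWaldspurgerFlat

end
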